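import Mathlib.Topology.Algebra.InfiniteSum.Real
import Mathlib.Topology.Algebra.InfiniteSum.ENNReal
import Mathlib.Analysis.SpecialFunctions.Pow.Real
import Mathlib.Algebra.Order.BigOperators.Ring.Finset
import Mathlib.Algebra.Order.Chebyshev
import HarnessLib

/-!
# The second-moment ("doubling") inequality of the transfer-matrix method, spectral-sum form

Topic `Literature/Analysis/OperatorTheory`; the elementary sequence-space inequalities behind the comparison of
thermal (periodic, `Tr(A^{M} 𝒳)/Tr A^{M}`) expectations at two different periods `M₁`, `M₂` of a transfer operator
`A ≥ 0` with eigenvalues `λᵢ ≥ 0` (Hilbert basis `bᵢ`), for an insertion `𝒳` of width `s` with matrix coefficients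
`x i j = ⟪bᵢ, 𝒳 bⱼ⟫`.  With `Z_M = Σ λᵢ^M`, `T_M = Σ λᵢ^{M-s} xᵢᵢ = Tr(A^{M-s} 𝒳)`, `E_M = T_M / Z_M` and the
two-point trace `Q = Σ_{i,j} λᵢ^a λⱼ^{a'} xⱼᵢ² = Tr(A^{a} 𝒳ᵀ A^{a'} 𝒳)`, `a + a' + 2s = M₁`:

* `sq_tsum_mul_le` — Cauchy–Schwarz for unconditional sums, `(Σ uᵢvᵢ)² ≤ Σuᵢ² Σvᵢ²`;
* `tsum_diag_le_tsum_prod` — the diagonal of a non-negative summable family on `ι × ι` is dominated by the total;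
* `sq_tsum_pow_three_le` — `(Σ μᵢ³)² ≤ (Σ μᵢ²)³` for `μᵢ ≥ 0` (so `Z_N Z_{3N} / Z_{2N}² ≤ (Z_{2N}/Z_N²)^{-1/2}`:
  `doublingRatio_sq_le`);
* `transfer_doubling_sq_le` (**main**) —
  `(E_{M₂} − E_{M₁})² ≤ (Q/Z_{M₁} − E_{M₁}²) · Z_{M₁} Z_{2M₂−M₁} / Z_{M₂}²`:
  the change of the thermal expectation under a change of period is controlled by the MIRROR COVARIANCE
  `Q/Z_{M₁} − E_{M₁}²` at period `M₁` times a ratio of partition functions (Cauchy–Schwarz in the eigenbasis after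
  centring by `E_{M₁}`, and domination of the centred diagonal sum by the two-point trace);
* `transfer_twist_sq_le` — the companion for a sign insertion `εᵢ` (flux twist `U`, `[U, A] = 0`, `U² = 1`):
  `(Tt/Zt − E_{M₁})² ≤ (Q/Z_{M₁} − E_{M₁}²) · (Z_{M₁}²/Zt² − 1)`, `Zt = Tr(A^{M₁}U)`, `Tt = Tr(A^{M₁−s}𝒳U)`.

Pure real analysis (HasSum bookkeeping), no operators; the operator/kernel side is `PositiveKernelSpectralTrace*.lean`.
[folklore]
-/

noncomputable section

open Filter Topology Finset

namespace Literature.Analysis.OperatorTheory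

variable {ι : Type*}

/-- **Cauchy–Schwarz for unconditional sums**: if `Σ uᵢ²` and `Σ vᵢ²` converge then `Σ uᵢ vᵢ` converges
(absolutely) and `(Σ uᵢ vᵢ)² ≤ (Σ uᵢ²)(Σ vᵢ²)`. [folklore] -/
theorem sq_tsum_mul_le {u v : ι → ℝ} (hu : Summable fun i => u i ^ 2) (hv : Summable fun i => v i ^ 2) :
    Summable (fun i => u i * v i) ∧ (∑' i, u i * v i) ^ 2 ≤ (∑' i, u i ^ 2) * ∑' i, v i ^ 2 := by
  have hs : Summable fun i => u i * v i := by
    refine Summable.of_norm_bounded ((hu.add hv).div_const 2) fun i => ?_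
    rw [Real.norm_eq_abs, abs_mul]
    have h := two_mul_le_add_sq |u i| |v i|
    rw [sq_abs, sq_abs] at h
    linarith
  refine ⟨hs, ?_⟩
  have ht : Tendsto (fun F : Finset ι => (∑ i ∈ F, u i * v i) ^ 2) atTop (𝓝 ((∑' i, u i * v i) ^ 2)) :=
    (hs.hasSum : Tendsto (fun F : Finset ι => ∑ i ∈ F, u i * v i) atTop (𝓝 (∑' i, u i * v i))).pow 2
  refine le_of_tendsto ht (Eventually.of_forall fun F => ?_)
  calc (∑ i ∈ F, u i * v i) ^ 2 ≤ (∑ i ∈ F, u i ^ 2) * ∑ i ∈ F, v i ^ 2 := sum_mul_sq_le_sq_mul_sq F u v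
    _ ≤ (∑' i, u i ^ 2) * ∑' i, v i ^ 2 :=
        mul_le_mul (hu.sum_le_tsum F fun i _ => sq_nonneg _) (hv.sum_le_tsum F fun i _ => sq_nonneg _)
          (sum_nonneg fun i _ => sq_nonneg _) (tsum_nonneg fun i => sq_nonneg _)

/-- The diagonal of a non-negative summable family on `ι × ι` is summable and dominated by the total sum.
[folklore] -/
theorem tsum_diag_le_tsum_prod {f : ι × ι → ℝ} (hf : Summable f) (hn : ∀ p, 0 ≤ f p) :
    Summable (fun i => f (i, i)) ∧ ∑' i, f (i, i) ≤ ∑' p, f p := by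
  have hinj : Function.Injective fun i : ι => (i, i) := fun a b h => congrArg Prod.fst h
  exact ⟨hf.comp_injective hinj, tsum_comp_le_tsum_of_inj hf hn hinj⟩

/-- **`‖μ‖₃ ≤ ‖μ‖₂` for non-negative sequences**, in the form `(Σ μᵢ³)² ≤ (Σ μᵢ²)³` (each `μᵢ ≤ (Σ μⱼ²)^{1/2}`).
[folklore] -/
theorem sq_tsum_pow_three_le {m : ι → ℝ} (h0 : ∀ i, 0 ≤ m i) (h2 : Summable fun i => m i ^ 2) :
    Summable (fun i => m i ^ 3) ∧ (∑' i, m i ^ 3) ^ 2 ≤ (∑' i, m i ^ 2) ^ 3 := by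
  set S := ∑' i, m i ^ 2 with hS
  have hS0 : 0 ≤ S := tsum_nonneg fun i => sq_nonneg _
  have hle : ∀ i, m i ≤ Real.sqrt S := fun i => by
    rw [← Real.sqrt_sq (h0 i)]
    exact Real.sqrt_le_sqrt (h2.le_tsum i fun j _ => sq_nonneg _)
  have hpt : ∀ i, m i ^ 3 ≤ Real.sqrt S * m i ^ 2 := fun i => by
    calc m i ^ 3 = m i * m i ^ 2 := by ring
      _ ≤ Real.sqrt S * m i ^ 2 := mul_le_mul_of_nonneg_right (hle i) (sq_nonneg _)
  have hs3 : Summable fun i => m i ^ 3 :=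
    Summable.of_nonneg_of_le (fun i => pow_nonneg (h0 i) 3) hpt (h2.mul_left _)
  refine ⟨hs3, ?_⟩
  have h1 : ∑' i, m i ^ 3 ≤ Real.sqrt S * S := by
    calc ∑' i, m i ^ 3 ≤ ∑' i, Real.sqrt S * m i ^ 2 := hs3.tsum_le_tsum hpt (h2.mul_left _)
      _ = Real.sqrt S * S := by rw [tsum_mul_left]
  have h3 : 0 ≤ ∑' i, m i ^ 3 := tsum_nonneg fun i => pow_nonneg (h0 i) 3
  calc (∑' i, m i ^ 3) ^ 2 ≤ (Real.sqrt S * S) ^ 2 := pow_le_pow_left₀ h3 h1 2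
    _ = S ^ 3 := by rw [mul_pow, Real.sq_sqrt hS0]; ring

/-- **The doubling ratio is controlled by the purity**: with `Z_M = Σ λᵢ^M` (`λᵢ ≥ 0`),
`(Z_N Z_{3N} / Z_{2N}²)² ≤ Z_N² / Z_{2N}` — i.e. `Z_N Z_{3N}/Z_{2N}² ≤ (Z_{2N}/Z_N²)^{-1/2}` (`sq_tsum_pow_three_le`
for `μᵢ = λᵢ^N`). [folklore] -/
theorem doublingRatio_sq_le {lam : ι → ℝ} (hlam : ∀ i, 0 ≤ lam i) {N : ℕ} {Z₁ Z₂ Z₃ : ℝ}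
    (hZ₁ : HasSum (fun i => lam i ^ N) Z₁) (hZ₂ : HasSum (fun i => lam i ^ (2 * N)) Z₂)
    (hZ₃ : HasSum (fun i => lam i ^ (3 * N)) Z₃) (hZ₂0 : 0 < Z₂) :
    (Z₁ * Z₃ / Z₂ ^ 2) ^ 2 ≤ Z₁ ^ 2 / Z₂ := by
  have h2 : Summable fun i => (lam i ^ N) ^ 2 := by
    simp_rw [← pow_mul, mul_comm N 2]; exact hZ₂.summable
  obtain ⟨-, h⟩ := sq_tsum_pow_three_le (fun i => pow_nonneg (hlam i) N) h2
  have e2 : ∑' i, (lam i ^ N) ^ 2 = Z₂ := by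
    simp_rw [← pow_mul, mul_comm N 2]; exact hZ₂.tsum_eq
  have e3 : ∑' i, (lam i ^ N) ^ 3 = Z₃ := by
    simp_rw [← pow_mul, mul_comm N 3]; exact hZ₃.tsum_eq
  rw [e2, e3] at h
  have hZ₁ := hZ₁.nonneg fun i => pow_nonneg (hlam i) N
  rw [div_pow, div_le_div_iff₀ (by positivity) hZ₂0]
  calc (Z₁ * Z₃) ^ 2 * Z₂ = Z₁ ^ 2 * Z₃ ^ 2 * Z₂ := by ring
    _ ≤ Z₁ ^ 2 * Z₂ ^ 3 * Z₂ := by gcongr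
    _ = Z₁ ^ 2 * (Z₂ ^ 2) ^ 2 := by ring

/-- **The transfer-matrix doubling (change-of-period) inequality, spectral-sum form.**  Let `λᵢ ≥ 0`, `x : ι → ι → ℝ`,
widths `s ≤ M₂` and arcs `a, a'` with `M₁ := a + a' + 2s` and `M₃ := 2M₂ − M₁`.  With `Z₁ = Σλᵢ^{M₁}`, `Z₂ = Σλᵢ^{M₂}`,
`Z₃ = Σλᵢ^{M₃}`, the one-point traces `T₁ = Σ λᵢ^{M₁−s} xᵢᵢ`, `T₂ = Σ λᵢ^{M₂−s} xᵢᵢ` and the two-point trace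
`Q = Σ_{i,j} λᵢ^{a} λⱼ^{a'} xⱼᵢ²`:
`(T₂/Z₂ − T₁/Z₁)² ≤ (Q/Z₁ − (T₁/Z₁)²) · Z₁ Z₃ / Z₂²`.
Proof: centre by `m = T₁/Z₁`; Cauchy–Schwarz `(Σ λ^{M₂−s}(xᵢᵢ − mλᵢ^s))² ≤ (Σ λ^{a+a'}(xᵢᵢ − mλᵢ^s)²)(Σ λ^{M₃})`;
the centred diagonal sum is `≤ Q − T₁²/Z₁` (diagonal of the non-negative two-point family). [folklore] -/
theorem transfer_doubling_sq_le {lam : ι → ℝ} (hlam : ∀ i, 0 ≤ lam i) {x : ι → ι → ℝ}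
    {s a a' M₂ M₃ : ℕ} {Z₁ Z₂ Z₃ T₁ T₂ Q : ℝ}
    (hM : a + a' + M₃ + 2 * s = 2 * M₂) (hsM : s ≤ M₂)
    (hZ₁ : HasSum (fun i => lam i ^ (a + a' + 2 * s)) Z₁) (hZ₂ : HasSum (fun i => lam i ^ M₂) Z₂)
    (hZ₃ : HasSum (fun i => lam i ^ M₃) Z₃)
    (hT₁ : HasSum (fun i => lam i ^ (a + a' + s) * x i i) T₁)
    (hT₂ : HasSum (fun i => lam i ^ (M₂ - s) * x i i) T₂)
    (hQ : HasSum (fun p : ι × ι => lam p.1 ^ a * lam p.2 ^ a' * x p.2 p.1 ^ 2) Q)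
    (hZ₁0 : 0 < Z₁) (hZ₂0 : 0 < Z₂) :
    (T₂ / Z₂ - T₁ / Z₁) ^ 2 ≤ (Q / Z₁ - (T₁ / Z₁) ^ 2) * (Z₁ * Z₃ / Z₂ ^ 2) := by
  set m := T₁ / Z₁ with hm
  -- the diagonal of the two-point family
  obtain ⟨hDs, hDle⟩ := tsum_diag_le_tsum_prod hQ.summable fun p =>
    mul_nonneg (mul_nonneg (pow_nonneg (hlam _) _) (pow_nonneg (hlam _) _)) (sq_nonneg _)
  set D := ∑' i, lam i ^ a * lam i ^ a' * x i i ^ 2 with hDdef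
  have hD : HasSum (fun i => lam i ^ a * lam i ^ a' * x i i ^ 2) D := hDs.hasSum
  have hDQ : D ≤ Q := by rw [hDdef, ← hQ.tsum_eq]; exact hDle
  -- the centred diagonal sum `V = D − 2 m T₁ + m² Z₁ ≤ Q − T₁²/Z₁ = Z₁ (Q/Z₁ − m²)`
  have hV : HasSum (fun i => lam i ^ (a + a') * (x i i - m * lam i ^ s) ^ 2) (D - 2 * m * T₁ + m ^ 2 * Z₁) := by
    have key := (hD.sub (hT₁.mul_left (2 * m))).add (hZ₁.mul_left (m ^ 2))
    have e : (fun i => lam i ^ (a + a') * (x i i - m * lam i ^ s) ^ 2) =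
        (fun i => lam i ^ a * lam i ^ a' * x i i ^ 2 - 2 * m * (lam i ^ (a + a' + s) * x i i) +
          m ^ 2 * lam i ^ (a + a' + 2 * s)) := funext fun i => by ring
    rw [e]
    exact key
  have hVle : D - 2 * m * T₁ + m ^ 2 * Z₁ ≤ Z₁ * (Q / Z₁ - m ^ 2) := by
    have e : Z₁ * (Q / Z₁ - m ^ 2) = Q - 2 * m * T₁ + m ^ 2 * Z₁ := by
      rw [hm]; field_simp; ring
    rw [e]; linarith
  -- Cauchy–Schwarz
  set u : ι → ℝ := fun i => Real.sqrt (lam i ^ (a + a')) * (x i i - m * lam i ^ s) with hu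
  set v : ι → ℝ := fun i => Real.sqrt (lam i ^ M₃) with hv
  have hu2 : ∀ i, u i ^ 2 = lam i ^ (a + a') * (x i i - m * lam i ^ s) ^ 2 := fun i => by
    simp only [hu, mul_pow, Real.sq_sqrt (pow_nonneg (hlam i) _)]
  have hv2 : ∀ i, v i ^ 2 = lam i ^ M₃ := fun i => Real.sq_sqrt (pow_nonneg (hlam i) _)
  have huv : ∀ i, u i * v i = lam i ^ (M₂ - s) * x i i - m * lam i ^ M₂ := fun i => by
    have h1 : Real.sqrt (lam i ^ (a + a')) * Real.sqrt (lam i ^ M₃) = lam i ^ (M₂ - s) := by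
      rw [← Real.sqrt_mul (pow_nonneg (hlam i) _), ← pow_add,
        show a + a' + M₃ = (M₂ - s) + (M₂ - s) by omega, pow_add, Real.sqrt_mul_self (pow_nonneg (hlam i) _)]
    have h2 : lam i ^ M₂ = lam i ^ (M₂ - s) * lam i ^ s := by rw [← pow_add, Nat.sub_add_cancel hsM]
    calc u i * v i = (Real.sqrt (lam i ^ (a + a')) * Real.sqrt (lam i ^ M₃)) * (x i i - m * lam i ^ s) := by
          simp only [hu, hv]; ring
      _ = lam i ^ (M₂ - s) * x i i - m * lam i ^ M₂ := by rw [h1, h2]; ring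
  have hsu : Summable fun i => u i ^ 2 := by simp_rw [hu2]; exact hV.summable
  have hsv : Summable fun i => v i ^ 2 := by simp_rw [hv2]; exact hZ₃.summable
  obtain ⟨-, hCS⟩ := sq_tsum_mul_le hsu hsv
  have hsum_uv : ∑' i, u i * v i = T₂ - m * Z₂ := by
    simp_rw [huv]; exact (hT₂.sub (hZ₂.mul_left m)).tsum_eq
  have hsum_u : ∑' i, u i ^ 2 = D - 2 * m * T₁ + m ^ 2 * Z₁ := by simp_rw [hu2]; exact hV.tsum_eq
  have hsum_v : ∑' i, v i ^ 2 = Z₃ := by simp_rw [hv2]; exact hZ₃.tsum_eq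
  rw [hsum_uv, hsum_u, hsum_v] at hCS
  have hZ₃0 : 0 ≤ Z₃ := hZ₃.nonneg fun i => pow_nonneg (hlam i) _
  have key : (T₂ - m * Z₂) ^ 2 ≤ Z₁ * (Q / Z₁ - m ^ 2) * Z₃ := hCS.trans (mul_le_mul_of_nonneg_right hVle hZ₃0)
  have e : (T₂ / Z₂ - m) ^ 2 = (T₂ - m * Z₂) ^ 2 / Z₂ ^ 2 := by
    field_simp
  rw [e, div_le_iff₀ (by positivity)]
  calc (T₂ - m * Z₂) ^ 2 ≤ Z₁ * (Q / Z₁ - m ^ 2) * Z₃ := key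
    _ = (Q / Z₁ - m ^ 2) * (Z₁ * Z₃ / Z₂ ^ 2) * Z₂ ^ 2 := by field_simp

/-- **The transfer-matrix twist (flux-insertion) inequality, spectral-sum form.**  Same setting as
`transfer_doubling_sq_le` at ONE period `M₁ = a + a' + 2s`, with a diagonal sign insertion `εᵢ`, `εᵢ² ≤ 1` (an involution
`U` commuting with `A`, in a joint eigenbasis): `Zt = Σ εᵢ λᵢ^{M₁} = Tr(A^{M₁} U)`, `Tt = Σ εᵢ λᵢ^{M₁−s} xᵢᵢ = Tr(A^{M₁−s} 𝒳 U)`.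
Then `(Tt/Zt − T₁/Z₁)² ≤ (Q/Z₁ − (T₁/Z₁)²) · (Z₁²/Zt² − 1)`: the twisted and untwisted thermal expectations agree up to the
mirror covariance times `1/w² − 1`, `w = Zt/Z₁` the twist weight (Cauchy–Schwarz after centring AND after projecting the
sign vector orthogonally to `(λᵢ^{M₁/2})`, which is what produces the `−1`). [folklore] -/
theorem transfer_twist_sq_le {lam : ι → ℝ} (hlam : ∀ i, 0 ≤ lam i) {x : ι → ι → ℝ} {ε : ι → ℝ}
    (hε : ∀ i, ε i ^ 2 ≤ 1) {s a a' : ℕ} {Z₁ Zt T₁ Tt Q : ℝ}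
    (hZ₁ : HasSum (fun i => lam i ^ (a + a' + 2 * s)) Z₁) (hZt : HasSum (fun i => ε i * lam i ^ (a + a' + 2 * s)) Zt)
    (hT₁ : HasSum (fun i => lam i ^ (a + a' + s) * x i i) T₁)
    (hTt : HasSum (fun i => ε i * (lam i ^ (a + a' + s) * x i i)) Tt)
    (hQ : HasSum (fun p : ι × ι => lam p.1 ^ a * lam p.2 ^ a' * x p.2 p.1 ^ 2) Q)
    (hZ₁0 : 0 < Z₁) (hZt0 : Zt ≠ 0) :
    (Tt / Zt - T₁ / Z₁) ^ 2 ≤ (Q / Z₁ - (T₁ / Z₁) ^ 2) * (Z₁ ^ 2 / Zt ^ 2 - 1) := by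
  set m := T₁ / Z₁ with hm
  set c := Zt / Z₁ with hc
  -- the diagonal of the two-point family and the centred diagonal sum, as in the doubling inequality
  obtain ⟨hDs, hDle⟩ := tsum_diag_le_tsum_prod hQ.summable fun p =>
    mul_nonneg (mul_nonneg (pow_nonneg (hlam _) _) (pow_nonneg (hlam _) _)) (sq_nonneg _)
  set D := ∑' i, lam i ^ a * lam i ^ a' * x i i ^ 2 with hDdef
  have hD : HasSum (fun i => lam i ^ a * lam i ^ a' * x i i ^ 2) D := hDs.hasSum
  have hDQ : D ≤ Q := by rw [hDdef, ← hQ.tsum_eq]; exact hDle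
  have hV : HasSum (fun i => lam i ^ (a + a') * (x i i - m * lam i ^ s) ^ 2) (D - 2 * m * T₁ + m ^ 2 * Z₁) := by
    have key := (hD.sub (hT₁.mul_left (2 * m))).add (hZ₁.mul_left (m ^ 2))
    have e : (fun i => lam i ^ (a + a') * (x i i - m * lam i ^ s) ^ 2) =
        (fun i => lam i ^ a * lam i ^ a' * x i i ^ 2 - 2 * m * (lam i ^ (a + a' + s) * x i i) +
          m ^ 2 * lam i ^ (a + a' + 2 * s)) := funext fun i => by ring
    rw [e]
    exact key
  have hVle : D - 2 * m * T₁ + m ^ 2 * Z₁ ≤ Z₁ * (Q / Z₁ - m ^ 2) := by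
    have e : Z₁ * (Q / Z₁ - m ^ 2) = Q - 2 * m * T₁ + m ^ 2 * Z₁ := by
      rw [hm]; field_simp; ring
    rw [e]; linarith
  -- Cauchy–Schwarz against the projected sign vector `v'ᵢ = (εᵢ − c) √(λᵢ^{M₁})`
  set u : ι → ℝ := fun i => Real.sqrt (lam i ^ (a + a')) * (x i i - m * lam i ^ s) with hu
  set v : ι → ℝ := fun i => (ε i - c) * Real.sqrt (lam i ^ (a + a' + 2 * s)) with hv
  have hu2 : ∀ i, u i ^ 2 = lam i ^ (a + a') * (x i i - m * lam i ^ s) ^ 2 := fun i => by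
    simp only [hu, mul_pow, Real.sq_sqrt (pow_nonneg (hlam i) _)]
  have hv2 : ∀ i, v i ^ 2 = (ε i - c) ^ 2 * lam i ^ (a + a' + 2 * s) := fun i => by
    simp only [hv, mul_pow, Real.sq_sqrt (pow_nonneg (hlam i) _)]
  have hsq : ∀ i, Real.sqrt (lam i ^ (a + a')) * Real.sqrt (lam i ^ (a + a' + 2 * s)) = lam i ^ (a + a' + s) :=
    fun i => by
    rw [← Real.sqrt_mul (pow_nonneg (hlam i) _), ← pow_add,
      show a + a' + (a + a' + 2 * s) = (a + a' + s) + (a + a' + s) by omega, pow_add,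
      Real.sqrt_mul_self (pow_nonneg (hlam i) _)]
  have huv : ∀ i, u i * v i = (ε i * (lam i ^ (a + a' + s) * x i i) - m * (ε i * lam i ^ (a + a' + 2 * s))) -
      c * (lam i ^ (a + a' + s) * x i i - m * lam i ^ (a + a' + 2 * s)) := fun i => by
    have h2 : lam i ^ (a + a' + 2 * s) = lam i ^ (a + a' + s) * lam i ^ s := by rw [← pow_add]; congr 1; omega
    calc u i * v i = (Real.sqrt (lam i ^ (a + a')) * Real.sqrt (lam i ^ (a + a' + 2 * s))) *
          ((ε i - c) * (x i i - m * lam i ^ s)) := by simp only [hu, hv]; ring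
      _ = _ := by rw [hsq, h2]; ring
  have hsu : Summable fun i => u i ^ 2 := by simp_rw [hu2]; exact hV.summable
  -- `Σ (εᵢ − c)² λᵢ^{M₁} ≤ Z₁ − Zt²/Z₁`
  have hε2s : Summable fun i => ε i ^ 2 * lam i ^ (a + a' + 2 * s) :=
    Summable.of_nonneg_of_le (fun i => mul_nonneg (sq_nonneg _) (pow_nonneg (hlam i) _))
      (fun i => by simpa using mul_le_mul_of_nonneg_right (hε i) (pow_nonneg (hlam i) (a + a' + 2 * s)))
      hZ₁.summable
  have hε2le : ∑' i, ε i ^ 2 * lam i ^ (a + a' + 2 * s) ≤ Z₁ := by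
    rw [← hZ₁.tsum_eq]
    exact hε2s.tsum_le_tsum (fun i => by
      simpa using mul_le_mul_of_nonneg_right (hε i) (pow_nonneg (hlam i) (a + a' + 2 * s))) hZ₁.summable
  have hvsum : HasSum (fun i => v i ^ 2)
      ((∑' i, ε i ^ 2 * lam i ^ (a + a' + 2 * s)) - 2 * c * Zt + c ^ 2 * Z₁) := by
    have key := (hε2s.hasSum.sub (hZt.mul_left (2 * c))).add (hZ₁.mul_left (c ^ 2))
    have e : (fun i => v i ^ 2) = fun i => ε i ^ 2 * lam i ^ (a + a' + 2 * s) -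
        2 * c * (ε i * lam i ^ (a + a' + 2 * s)) + c ^ 2 * lam i ^ (a + a' + 2 * s) := funext fun i => by
      rw [hv2]; ring
    rw [e]
    exact key
  have hsv : Summable fun i => v i ^ 2 := hvsum.summable
  have hvle : ∑' i, v i ^ 2 ≤ Z₁ - Zt ^ 2 / Z₁ := by
    rw [hvsum.tsum_eq]
    have e : Z₁ - Zt ^ 2 / Z₁ = Z₁ - 2 * c * Zt + c ^ 2 * Z₁ := by rw [hc]; field_simp; ring
    rw [e]; linarith
  obtain ⟨-, hCS⟩ := sq_tsum_mul_le hsu hsv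
  have hsum_uv : ∑' i, u i * v i = Tt - m * Zt := by
    simp_rw [huv]
    have h1 := (hTt.sub (hZt.mul_left m)).sub ((hT₁.sub (hZ₁.mul_left m)).mul_left c)
    rw [h1.tsum_eq]
    have h0 : T₁ - m * Z₁ = 0 := by rw [hm]; field_simp; ring
    rw [h0, mul_zero, sub_zero]
  have hsum_u : ∑' i, u i ^ 2 = D - 2 * m * T₁ + m ^ 2 * Z₁ := by simp_rw [hu2]; exact hV.tsum_eq
  rw [hsum_uv, hsum_u] at hCS
  have hVnn : 0 ≤ D - 2 * m * T₁ + m ^ 2 * Z₁ :=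
    hV.nonneg fun i => mul_nonneg (pow_nonneg (hlam i) _) (sq_nonneg _)
  have key : (Tt - m * Zt) ^ 2 ≤ Z₁ * (Q / Z₁ - m ^ 2) * (Z₁ - Zt ^ 2 / Z₁) :=
    calc (Tt - m * Zt) ^ 2 ≤ (D - 2 * m * T₁ + m ^ 2 * Z₁) * ∑' i, v i ^ 2 := hCS
      _ ≤ (D - 2 * m * T₁ + m ^ 2 * Z₁) * (Z₁ - Zt ^ 2 / Z₁) := mul_le_mul_of_nonneg_left hvle hVnn
      _ ≤ Z₁ * (Q / Z₁ - m ^ 2) * (Z₁ - Zt ^ 2 / Z₁) := by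
          refine mul_le_mul_of_nonneg_right hVle ?_
          have : Zt ^ 2 / Z₁ ≤ Z₁ := by
            rw [div_le_iff₀ hZ₁0]
            -- `Zt² ≤ Z₁²` from `|εᵢ| ≤ 1`
            have hab : |Zt| ≤ Z₁ := by
              have h1 : ∀ i, |ε i * lam i ^ (a + a' + 2 * s)| ≤ lam i ^ (a + a' + 2 * s) := fun i => by
                rw [abs_mul, abs_of_nonneg (pow_nonneg (hlam i) _)]
                have : |ε i| ≤ 1 := by
                  have := hε i
                  nlinarith [abs_nonneg (ε i), sq_abs (ε i)]
                simpa using mul_le_mul_of_nonneg_right this (pow_nonneg (hlam i) (a + a' + 2 * s))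
              calc |Zt| = ‖∑' i, ε i * lam i ^ (a + a' + 2 * s)‖ := by rw [hZt.tsum_eq, Real.norm_eq_abs]
                _ ≤ ∑' i, ‖ε i * lam i ^ (a + a' + 2 * s)‖ := norm_tsum_le_tsum_norm
                    (Summable.of_nonneg_of_le (fun i => norm_nonneg _) (fun i => by
                      rw [Real.norm_eq_abs]; exact h1 i) hZ₁.summable)
                _ ≤ ∑' i, lam i ^ (a + a' + 2 * s) := Summable.tsum_le_tsum (fun i => by
                      rw [Real.norm_eq_abs]; exact h1 i)
                    (Summable.of_nonneg_of_le (fun i => norm_nonneg _) (fun i => by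
                      rw [Real.norm_eq_abs]; exact h1 i) hZ₁.summable) hZ₁.summable
                _ = Z₁ := hZ₁.tsum_eq
            nlinarith [abs_nonneg Zt, sq_abs Zt, abs_le.mp hab]
          linarith
  have e : (Tt / Zt - m) ^ 2 = (Tt - m * Zt) ^ 2 / Zt ^ 2 := by
    field_simp
  rw [e, div_le_iff₀ (by positivity)]
  calc (Tt - m * Zt) ^ 2 ≤ Z₁ * (Q / Z₁ - m ^ 2) * (Z₁ - Zt ^ 2 / Z₁) := key
    _ = (Q / Z₁ - m ^ 2) * (Z₁ ^ 2 / Zt ^ 2 - 1) * Zt ^ 2 := by field_simp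

end Literature.Analysis.OperatorTheory

end
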